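import Summits.QuantumFields.BalabanUV.Beta.D1BFx.TadpoleParity
import Summits.QuantumFields.BalabanUV.Beta.ChartConjugationReflection
import Summits.QuantumFields.BalabanUV.Beta.KernelWardRelative

/-!
# `BalabanUV.Beta.D1BFx.Criticality` — road «BF-x» for binder row D1, leaf K-R4 (criticality / chain-rule CHECK), part 2:
# the tadpole of the SECOND-RESPONSE summand `dM K′ N S M μ y` of the second-order carrier is — exactly, by Fubini — the superposition
# of the ONE-POINT FUNCTIONS `tadpole K (S κ u)`, `tadpole K (M ρ w)` of the first-order tables, weighted by the columns of `K′`;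
# hence it VANISHES when they do (the typed shadow of B12 (4.35)'s `tr_C (ad t_e) = 0`), and at the wall's member `0` it is EXACTLY
# `cVH ·` the superposition of the vh one-point functions (part 1 kills the Wilson and the multiplier ones by parity)

HONEST FRAMING (cell contract, verbatim): «discharging `BetaPertH` makes Bałaban's UV stability UNCONDITIONAL — a real constructive-QFT
result; it is NOT the continuum limit and NOT the Clay problem.»  This module is [folklore] absolutely-convergent-sum bookkeeping over the
cell's typed objects (`ExpKernelCalculus`, `OneStepResolventKernel.wsum`, `InterLevelTransport.cwsum/onLat`, `OneStepKernelFamily.colH/vertexOfK`,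
`SecondOrderResponse.colM/vertexOfM/dM/K2OfK/W2OfK`, `TameKernelCalculus`, `ChartConjugationReflection.comp_wsum`, `BalabanStepW2.Spure/M1` BY
NAME).  It cites nothing, mints no `Prop`, instantiates no binder of the β-function wall and discharges nothing of it.  NOT summit progress;
NOT BetaPertH, NOT continuum, NOT Clay.
HONEST DEPENDENCY: continuum YM on T⁴ ⇐ BetaPertH ∧ nine spine estimates (0/9 proved); BetaPertH ⇐ (D1) ∧ (D4) ∧ CAP+tail; G-an2-4 gates
asym, D1 and NE2/3/4.

WHY (skeleton `HOME/beta/skeletons/D1-b2b-balaban-beta-d1-p2.md` node R, leaf R4; QUESTION X-d1p2-2, journal l.5435; claim table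
`HOME/b2b-balaban-beta-d1-p2/LEAVES-BFx.md` row K-R4).  `W2OfK K N S M S₂ M₂ μ y ν y′ = vertex2OfK + mixOfK + mixOfK′ + dM (K2OfK … ν y′) N S M μ y`;
the last summand is `Σ_{(κ,u)} X″(κ,u)·S κ u + Σ_{(ρ,w)} Φ″(ρ,w)·M ρ w` (`X″`/`Φ″` = field / multiplier rows of the `(μ,y)`-column of the second
response `K′ = −K∘(dM …)∘K`) and enters `hessKer` only through `½·tadpole K (W μ 0 ν z)`.  CONTENT:
* §1 FUBINI: `tr_wsum` (weights decaying from a point, family bi-localised at its own index ⟹ `tr (wsum w G) = Σ' u, w u · tr (G u)`;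
  `KernelWard.tsum_comm_of_prodBound`), `tadpole_wsum` (via `ChartConjugationReflection.comp_wsum`; finite sums by `KernelWardRelative`).
* §2 for ANY bi-localised `K′` (the second response is one: `SecondOrderResponse.vertexFamily_K2OfK`): **`tadpole_vertexOfK`**
  `tadpole K (vertexOfK K′ N S μ y) = Σ_κ Σ'_u colH K′ N μ y κ u · tadpole K (S κ u)`, **`tadpole_vertexOfM`** (`colM`, `M ρ w`), **`tadpole_dM`**.
* §3 CRITICALITY: **`tadpole_dM_eq_zero_of_onePoint`** (all one-point functions `tadpole K (S κ u)`, `tadpole K (M ρ w)` vanish ⟹ the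
  second-response summand has no tadpole) and **`tadpole_W2OfK_eq_of_onePoint`** (`tadpole K (W2OfK …) = tadpole K (first three summands)`) —
  the typed form of leaf R4's «`tr_C (ad t_c) = 0` ⇒ no first-order term» (B12 (4.35)'s mechanism; context only).
* PART 3 (`D1BFx/CriticalityWall`) THE CHECK AT THE WALL'S MEMBER `0` (`S := Spure … 0 = cE•wilsonA + cVH•mfNeg vhS`, `M := M1 … 0 = (cΛ·wM1)•hessFF`, the tables of
  `BalabanStepW2.WbalOf … 0`), ANY sgn-symmetric spread `K` (`BubbleParity.trK_KInvStep`), ANY bi-localised `K′`: **`tadpole_dM_Spure_zero`**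
  `tadpole K (dM K′ Lc (Spure … 0) (M1 … 0) μ y) = cVH · Σ_κ Σ'_u colH K′ Lc μ y κ u · tadpole K (mfNeg (vhS d Lc κ u))` — the Wilson and the
  multiplier one-point functions are ZERO by parity (part 1); EXACTLY the vh ones survive.  Nothing is asserted about their value (the
  colourless model has no parity for an OFF-diagonal table: the residual finite question of K-R4, recorded in the claim table).
-/

open Finset
open scoped BigOperators
open Literature.Probability.LatticeModels (Torus.proj)
open Literature.MathematicalPhysics.QuantumFieldTheory
open Literature.MathematicalPhysics.QuantumFieldTheory.Balaban1983to89
open Literature.MathematicalPhysics.QuantumFieldTheory.Balaban1983to89.Beta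
open B12Sec2to5 (l1 l1_nonneg)
open ExpKernelCalculus (MKer Decays BiLoc comp tr tadpole VertexFamily summable_exp_shift summable_exp_shift' l1_sub_triangle Zl
  biLoc_comp_decays)
open KernelWard (ProdBound tsum_comm_of_prodBound)
open OneStepResolventKernel (Fib LocStencil wsum biLoc_wsum eq_zsmul_quo_of_proj)
open OneStepKernelFamily (colH vertexOfK)
open InterLevelTransport (onLat cwsum onLat_zsmul onLat_off biLoc_cwsum)
open SecondOrderResponse (colM vertexOfM dM K2OfK vertex2OfK mixOfK W2OfK abs_colH_le_of_biLoc abs_colM_le_of_biLoc)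
open Summit.QuantumFields.BalabanUV.Beta.TameKernelCalculus
open Summit.QuantumFields.BalabanUV.Beta.ChartConjugationReflection (comp_wsum)
open Summit.QuantumFields.BalabanUV.Beta.KernelWardRelative (loc_finset_sum tadpole_finset_sum)

namespace Summit.QuantumFields.BalabanUV.Beta.D1BFx.Criticality

noncomputable section

/-! ## §1 Fubini for traces and tadpoles of weighted superpositions -/

section Fubini

variable {D : ℕ} {F : Type*} [Fintype F]

omit [Fintype F] in
/-- [folklore] Weights dominated by an exponential from a point are absolutely summable. -/
theorem summable_abs_of_expBound {w : (Fin D → ℤ) → ℝ} {Cw m : ℝ} {p : Fin D → ℤ} (hm : 0 < m)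
    (hw : ∀ u, |w u| ≤ Cw * Real.exp (-m * l1 (u - p))) : Summable fun u => |w u| :=
  Summable.of_nonneg_of_le (fun _ => abs_nonneg _) hw ((summable_exp_shift' hm p).mul_left Cw)

omit [Fintype F] in
/-- [folklore] The constant of an exponential weight bound is nonnegative. -/
theorem nonneg_of_expBound {w : (Fin D → ℤ) → ℝ} {Cw m : ℝ} {p : Fin D → ℤ} (hw : ∀ u, |w u| ≤ Cw * Real.exp (-m * l1 (u - p))) :
    0 ≤ Cw := by
  have h := hw p
  rw [sub_self] at h
  have h0 : l1 (0 : Fin D → ℤ) = 0 := by simp [l1]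
  rw [h0, mul_zero, Real.exp_zero, mul_one] at h
  exact (abs_nonneg _).trans h

/-- [folklore] **FUBINI FOR THE TRACE OF A SUPERPOSITION.**  Weights decaying exponentially from a point `p`, a family `G u` bi-localised
at its own index `(u, u)` with uniform constant and rate ⟹ `tr (Σ'_u w u • G u) = Σ'_u w u · tr (G u)` (product majorant
`e^{−δ′|x−p|} ⊗ |w u| e^{δ′|u−p|}`, `δ′ = min δ (m/2)`; `KernelWard.tsum_comm_of_prodBound`). -/
theorem tr_wsum {w : (Fin D → ℤ) → ℝ} {G : (Fin D → ℤ) → MKer D F} {Cw m : ℝ} {p : Fin D → ℤ} (hm : 0 < m)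
    (hw : ∀ u, |w u| ≤ Cw * Real.exp (-m * l1 (u - p))) {C δ : ℝ} (hδ : 0 < δ) (hG : ∀ u, BiLoc (G u) u u C δ) :
    tr (wsum w G) = ∑' u, w u * tr (G u) := by
  classical
  have hCw : 0 ≤ Cw := nonneg_of_expBound hw
  -- entry bound: `|G u x x a a| ≤ C`
  have hGle : ∀ u x a, |G u x x a a| ≤ C := fun u x a => by
    have hC : 0 ≤ C := (hG u).nonneg a
    refine (hG u x x a a).trans ?_
    have : Real.exp (-δ * (l1 (x - u) + l1 (x - u))) ≤ 1 :=
      Real.exp_le_one_iff.mpr (by nlinarith [l1_nonneg (x - u)])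
    nlinarith
  -- summability in `u` of each entry term
  have hsum : ∀ x a, Summable fun u => w u * G u x x a a := fun x a => by
    refine Summable.of_norm_bounded (((summable_exp_shift' hm p).mul_left Cw).mul_right C) (fun u => ?_)
    rw [Real.norm_eq_abs, abs_mul]
    exact mul_le_mul (hw u) (hGle u x a) (abs_nonneg _) ((abs_nonneg _).trans (hw u))
  -- step 1: the finite fibre sum inside
  have step1 : (fun x => ∑ a, wsum w G x x a a) = fun x => ∑' u, ∑ a, w u * G u x x a a := by
    funext x
    rw [Summable.tsum_finsetSum (fun a _ => hsum x a)]
    rfl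
  -- step 2: the product majorant
  set δ' : ℝ := min δ (m / 2) with hδ'
  have hδ'pos : 0 < δ' := lt_min hδ (half_pos hm)
  have hδ'δ : δ' ≤ δ := min_le_left _ _
  have hδ'm : δ' ≤ m / 2 := min_le_right _ _
  have hFC : 0 ≤ (Fintype.card F : ℝ) * C := by
    rcases isEmpty_or_nonempty F with hF | ⟨⟨a⟩⟩
    · simp
    · exact mul_nonneg (Nat.cast_nonneg _) ((hG p).nonneg a)
  have hPB : ProdBound (fun x u => ∑ a, w u * G u x x a a) := by
    refine ⟨fun x => (Fintype.card F : ℝ) * C * Real.exp (-δ' * l1 (x - p)), fun u => Cw * Real.exp (-(m / 2) * l1 (u - p)),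
      (summable_exp_shift' hδ'pos p).mul_left _, (summable_exp_shift' (half_pos hm) p).mul_left _, fun x => by positivity,
      fun u => by positivity, fun x u => ?_⟩
    -- `|Σ_a w u G u x x a a| ≤ |F|·C·e^{−δ′|x−u|}·|w u| ≤ (|F| C e^{−δ′|x−p|})·(Cw e^{−(m/2)|u−p|})`
    have hterm : ∀ a, |w u * G u x x a a| ≤ |w u| * (C * Real.exp (-δ' * l1 (x - u))) := fun a => by
      rw [abs_mul]
      refine mul_le_mul_of_nonneg_left ((hG u x x a a).trans ?_) (abs_nonneg _)
      exact mul_le_mul_of_nonneg_left (Real.exp_le_exp.mpr (by nlinarith [l1_nonneg (x - u)])) ((hG u).nonneg a)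
    have htri : -δ' * l1 (x - u) ≤ -δ' * l1 (x - p) + δ' * l1 (u - p) := by
      have := l1_sub_triangle x u p
      nlinarith
    have hwu : |w u| * Real.exp (δ' * l1 (u - p)) ≤ Cw * Real.exp (-(m / 2) * l1 (u - p)) := by
      calc |w u| * Real.exp (δ' * l1 (u - p)) ≤ Cw * Real.exp (-m * l1 (u - p)) * Real.exp (δ' * l1 (u - p)) :=
            mul_le_mul_of_nonneg_right (hw u) (Real.exp_pos _).le
        _ = Cw * Real.exp (-m * l1 (u - p) + δ' * l1 (u - p)) := by rw [Real.exp_add]; ring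
        _ ≤ Cw * Real.exp (-(m / 2) * l1 (u - p)) :=
            mul_le_mul_of_nonneg_left (Real.exp_le_exp.mpr (by nlinarith [l1_nonneg (u - p)])) hCw
    calc |∑ a, w u * G u x x a a| ≤ ∑ a, |w u * G u x x a a| := Finset.abs_sum_le_sum_abs _ _
      _ ≤ ∑ _a : F, |w u| * (C * Real.exp (-δ' * l1 (x - u))) := Finset.sum_le_sum fun a _ => hterm a
      _ = (Fintype.card F : ℝ) * C * (Real.exp (-δ' * l1 (x - u)) * |w u|) := by
          rw [Finset.sum_const, Finset.card_univ, nsmul_eq_mul]; ring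
      _ ≤ (Fintype.card F : ℝ) * C * (Real.exp (-δ' * l1 (x - p) + δ' * l1 (u - p)) * |w u|) :=
          mul_le_mul_of_nonneg_left (mul_le_mul_of_nonneg_right (Real.exp_le_exp.mpr htri) (abs_nonneg _)) hFC
      _ = (Fintype.card F : ℝ) * C * Real.exp (-δ' * l1 (x - p)) * (|w u| * Real.exp (δ' * l1 (u - p))) := by
          rw [Real.exp_add]; ring
      _ ≤ (Fintype.card F : ℝ) * C * Real.exp (-δ' * l1 (x - p)) * (Cw * Real.exp (-(m / 2) * l1 (u - p))) :=
          mul_le_mul_of_nonneg_left hwu (by positivity)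
  -- step 3: exchange and refold
  unfold ExpKernelCalculus.tr
  rw [step1, tsum_comm_of_prodBound hPB]
  refine tsum_congr fun u => ?_
  rw [← tsum_mul_left]
  refine tsum_congr fun x => ?_
  rw [Finset.mul_sum]

/-- [folklore] From `Spr K` and a family bi-localised at its own index (uniform constant, rate `δ > 0`): the composed family
`u ↦ K ∘ Cf u` is bi-localised at `(u, u)` with a uniform constant and positive rate. -/
theorem biLoc_comp_family {K : MKer D F} (hK : Spr K) {Cf : (Fin D → ℤ) → MKer D F} {C δ : ℝ} (hδ : 0 < δ)
    (hCf : ∀ u, BiLoc (Cf u) u u C δ) :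
    ∃ C₁ δ₁ : ℝ, 0 < δ₁ ∧ ∀ u, BiLoc (comp K (Cf u)) u u C₁ δ₁ := by
  obtain ⟨CK, δK, hδK, hKd⟩ := hK
  set δ₀ : ℝ := min δK δ with hδ₀
  have hδ₀pos : 0 < δ₀ := lt_min hδK hδ
  have hK0 : Decays K (|CK|) δ₀ := decays_of_le hKd (min_le_left _ _)
  refine ⟨(Fintype.card F : ℝ) * (|CK| * |C|) * Zl D (δ₀ - δ₀ / 2), δ₀ / 2, half_pos hδ₀pos, fun u => ?_⟩
  exact biLoc_comp_decays hK0 (biLoc_of_le (hCf u) (min_le_right _ _)) (half_pos hδ₀pos).le (half_lt_self hδ₀pos)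

/-- [folklore] **FUBINI FOR THE TADPOLE OF A SUPERPOSITION**: spread propagator, weights decaying exponentially from a point, family
bi-localised at its own index ⟹ `tadpole K (Σ'_u w u • Cf u) = Σ'_u w u · tadpole K (Cf u)`. -/
theorem tadpole_wsum {K : MKer D F} (hK : Spr K) {w : (Fin D → ℤ) → ℝ} {Cf : (Fin D → ℤ) → MKer D F} {Cw m : ℝ}
    {p : Fin D → ℤ} (hm : 0 < m) (hw : ∀ u, |w u| ≤ Cw * Real.exp (-m * l1 (u - p))) {C δ : ℝ} (hδ : 0 < δ)
    (hCf : ∀ u, BiLoc (Cf u) u u C δ) :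
    tadpole K (wsum w Cf) = ∑' u, w u * tadpole K (Cf u) := by
  have hB : ∀ u x z a b, |Cf u x z a b| ≤ |C| := fun u x z a b => by
    refine (hCf u x z a b).trans ?_
    have h1 : Real.exp (-δ * (l1 (x - u) + l1 (z - u))) ≤ 1 :=
      Real.exp_le_one_iff.mpr (by nlinarith [l1_nonneg (x - u), l1_nonneg (z - u)])
    calc C * Real.exp (-δ * (l1 (x - u) + l1 (z - u))) ≤ |C| * Real.exp (-δ * (l1 (x - u) + l1 (z - u))) :=
          mul_le_mul_of_nonneg_right (le_abs_self C) (Real.exp_pos _).le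
      _ ≤ |C| * 1 := mul_le_mul_of_nonneg_left h1 (abs_nonneg C)
      _ = |C| := mul_one _
  obtain ⟨C₁, δ₁, hδ₁, hG⟩ := biLoc_comp_family hK hδ hCf
  unfold ExpKernelCalculus.tadpole
  rw [comp_wsum hK (summable_abs_of_expBound hm hw) (abs_nonneg C) hB]
  exact tr_wsum hm hw hδ₁ hG

end Fubini

/-! ## §2 The second-response tadpole is a superposition of one-point functions -/

section Response

variable {d : ℕ} {N : ℕ}

/-- [folklore] The chain-rule vertex as a finite sum of superpositions (unfolding `OneStepKernelFamily.vertexOfK`). -/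
theorem vertexOfK_eq_sum (K' : MKer (d + 1) (Fib d)) (S : Fin (d + 1) → (Fin (d + 1) → ℤ) → MKer (d + 1) (Fib d))
    (μ : Fin (d + 1)) (y : Fin (d + 1) → ℤ) : vertexOfK K' N S μ y = ∑ κ : Fin (d + 1), wsum (colH K' N μ y κ) (S κ) := by
  funext x z a b
  simp only [OneStepKernelFamily.vertexOfK, Finset.sum_apply]

/-- [folklore] The multiplier-column vertex as a finite sum of coarse superpositions (unfolding `SecondOrderResponse.vertexOfM`). -/
theorem vertexOfM_eq_sum (K' : MKer (d + 1) (Fib d)) (M : Fin (d + 1) → (Fin (d + 1) → ℤ) → MKer (d + 1) (Fib d))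
    (μ : Fin (d + 1)) (y : Fin (d + 1) → ℤ) : vertexOfM K' N M μ y = ∑ ρ : Fin (d + 1), cwsum N (colM K' N μ y ρ) (M ρ) := by
  funext x z a b
  simp only [SecondOrderResponse.vertexOfM, Finset.sum_apply]

/-- [folklore] **THE FIELD PART.**  For a spread propagator `K`, ANY kernel `K′` bi-localised at a coarse point (e.g. the second response
`K2OfK K N S M ν y′`, `SecondOrderResponse.vertexFamily_K2OfK`) and a local stencil family `S`:
`tadpole K (vertexOfK K′ N S μ y) = Σ_κ Σ'_u colH K′ N μ y κ u · tadpole K (S κ u)` — the field rows of the `(μ,y)`-column of `K′` against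
the ONE-POINT FUNCTIONS of the stencils. -/
theorem tadpole_vertexOfK {K K' : MKer (d + 1) (Fib d)} (hK : Spr K) {q : Fin (d + 1) → ℤ} {C' m : ℝ} (hK' : BiLoc K' q q C' m)
    (hm : 0 < m) {S : Fin (d + 1) → (Fin (d + 1) → ℤ) → MKer (d + 1) (Fib d)} {Cs δs : ℝ} (hS : LocStencil S Cs δs) (hδs : 0 < δs)
    (μ : Fin (d + 1)) (y : Fin (d + 1) → ℤ) :
    tadpole K (vertexOfK K' N S μ y) = ∑ κ : Fin (d + 1), ∑' u, colH K' N μ y κ u * tadpole K (S κ u) := by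
  -- common rate
  set r : ℝ := min m δs with hr
  have hrpos : 0 < r := lt_min hm hδs
  have hK'r : BiLoc K' q q (|C'|) r := biLoc_of_le hK' (min_le_left _ _)
  have hSr : ∀ κ u, BiLoc (S κ u) u u (|Cs|) r := fun κ u => biLoc_of_le (hS κ u) (min_le_right _ _)
  have hw : ∀ κ u, |colH K' N μ y κ u| ≤ |C'| * Real.exp (-r * l1 ((N : ℤ) • y - q)) * Real.exp (-r * l1 (u - q)) :=
    fun κ u => abs_colH_le_of_biLoc hK'r μ y κ u
  have hCw : 0 ≤ |C'| * Real.exp (-r * l1 ((N : ℤ) • y - q)) := by positivity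
  have hloc : ∀ κ : Fin (d + 1), Loc (wsum (colH K' N μ y κ) (S κ)) := fun κ =>
    ⟨q, q, _, r / 2, half_pos hrpos, biLoc_wsum (hw κ) (hSr κ) hrpos hCw⟩
  rw [vertexOfK_eq_sum, tadpole_finset_sum _ hK hloc]
  exact Finset.sum_congr rfl fun κ _ => tadpole_wsum hK hrpos (hw κ) hrpos (hSr κ)

/-- [folklore] **THE MULTIPLIER PART.**  `tadpole K (vertexOfM K′ N M μ y) = Σ_ρ Σ'_w colM K′ N μ y ρ w · tadpole K (M ρ w)` — the multiplier
rows of the `(μ,y)`-column of `K′` against the one-point functions of the multiplier tables (the coarse-indexed superposition `cwsum` is a fine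
`wsum` of extensions by zero; the fine sum is re-indexed along `w ↦ N•w`). -/
theorem tadpole_vertexOfM [NeZero N] {K K' : MKer (d + 1) (Fib d)} (hK : Spr K) {q : Fin (d + 1) → ℤ} {C' m : ℝ}
    (hK' : BiLoc K' q q C' m) (hm : 0 < m) {M : Fin (d + 1) → (Fin (d + 1) → ℤ) → MKer (d + 1) (Fib d)} {CM δM : ℝ}
    (hM : VertexFamily M N CM δM) (hδM : 0 < δM) (μ : Fin (d + 1)) (y : Fin (d + 1) → ℤ) :
    tadpole K (vertexOfM K' N M μ y) = ∑ ρ : Fin (d + 1), ∑' w, colM K' N μ y ρ w * tadpole K (M ρ w) := by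
  set r : ℝ := min m δM with hr
  have hrpos : 0 < r := lt_min hm hδM
  have hK'r : BiLoc K' q q (|C'|) r := biLoc_of_le hK' (min_le_left _ _)
  have hMr : ∀ ρ w, BiLoc (M ρ w) ((N : ℤ) • w) ((N : ℤ) • w) (|CM|) r := fun ρ w => biLoc_of_le (hM ρ w) (min_le_right _ _)
  have hw : ∀ ρ w, |colM K' N μ y ρ w| ≤ |C'| * Real.exp (-r * l1 ((N : ℤ) • y - q)) * Real.exp (-r * l1 ((N : ℤ) • w - q)) :=
    fun ρ w => abs_colM_le_of_biLoc hK'r μ y ρ w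
  have hCw : 0 ≤ |C'| * Real.exp (-r * l1 ((N : ℤ) • y - q)) := by positivity
  -- the extensions by zero: weights and family on the fine lattice
  have hw' : ∀ ρ v, |onLat N (colM K' N μ y ρ) v| ≤ |C'| * Real.exp (-r * l1 ((N : ℤ) • y - q)) * Real.exp (-r * l1 (v - q)) := by
    intro ρ v
    by_cases hv : Torus.proj N v = 0
    · have e := eq_zsmul_quo_of_proj (N := N) hv
      simp only [onLat, hv, if_true]
      have h := hw ρ (LatticeForm.quo N v)
      rwa [← e] at h
    · rw [onLat_off _ hv, abs_zero]; positivity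
  have hM' : ∀ ρ v, BiLoc (onLat N (M ρ) v) v v (|CM|) r := by
    intro ρ v
    by_cases hv : Torus.proj N v = 0
    · have e := eq_zsmul_quo_of_proj (N := N) hv
      simp only [onLat, hv, if_true]
      have h := hMr ρ (LatticeForm.quo N v)
      rwa [← e] at h
    · intro x z a b
      rw [onLat_off _ hv]
      show |(0 : ℝ)| ≤ _
      rw [abs_zero]; positivity
  have hloc : ∀ ρ : Fin (d + 1), Loc (cwsum N (colM K' N μ y ρ) (M ρ)) := fun ρ =>
    ⟨q, q, _, r / 2, half_pos hrpos, biLoc_cwsum (hw ρ) (hMr ρ) hrpos hCw⟩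
  rw [vertexOfM_eq_sum, tadpole_finset_sum _ hK hloc]
  refine Finset.sum_congr rfl fun ρ _ => ?_
  -- `cwsum = wsum` of the extensions; Fubini; re-index the fine sum along `w ↦ N • w`
  have h1 : tadpole K (cwsum N (colM K' N μ y ρ) (M ρ)) =
      ∑' v, onLat N (colM K' N μ y ρ) v * tadpole K (onLat N (M ρ) v) :=
    tadpole_wsum hK hrpos (hw' ρ) hrpos (hM' ρ)
  rw [h1]
  have hinj : Function.Injective (fun w : (Fin (d + 1) → ℤ) => (N : ℤ) • w) :=
    smul_right_injective (Fin (d + 1) → ℤ) ((Nat.cast_ne_zero (R := ℤ)).mpr (NeZero.ne N))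
  rw [← hinj.tsum_eq (f := fun v => onLat N (colM K' N μ y ρ) v * tadpole K (onLat N (M ρ) v))]
  · exact tsum_congr fun w => by simp only [onLat_zsmul]
  · intro v hv
    by_cases h0 : Torus.proj N v = 0
    · exact ⟨LatticeForm.quo N v, (eq_zsmul_quo_of_proj (N := N) h0).symm⟩
    · refine (Function.mem_support.mp hv ?_).elim
      show onLat N (colM K' N μ y ρ) v * tadpole K (onLat N (M ρ) v) = 0
      rw [onLat_off _ h0, zero_mul]

/-- [folklore] Localisation of the two chain-rule vertices through a bi-localised `K′` (rates normalised; `SecondOrderResponse` §4). -/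
theorem loc_vertexOfK {K' : MKer (d + 1) (Fib d)} {q : Fin (d + 1) → ℤ} {C' m : ℝ} (hK' : BiLoc K' q q C' m) (hm : 0 < m)
    {S : Fin (d + 1) → (Fin (d + 1) → ℤ) → MKer (d + 1) (Fib d)} {Cs δs : ℝ} (hS : LocStencil S Cs δs) (hδs : 0 < δs)
    (μ : Fin (d + 1)) (y : Fin (d + 1) → ℤ) : Loc (vertexOfK K' N S μ y) := by
  have hrpos : 0 < min m δs := lt_min hm hδs
  have h := SecondOrderResponse.biLoc_vertexOfK_of_biLoc (N := N) (biLoc_of_le hK' (min_le_left m δs))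
    (fun κ u => biLoc_of_le (hS κ u) (min_le_right m δs)) hrpos μ y
  exact ⟨q, q, _, _, half_pos hrpos, h⟩

/-- [folklore] Localisation of the multiplier-column vertex through a bi-localised `K′`. -/
theorem loc_vertexOfM [NeZero N] {K' : MKer (d + 1) (Fib d)} {q : Fin (d + 1) → ℤ} {C' m : ℝ} (hK' : BiLoc K' q q C' m)
    (hm : 0 < m) {M : Fin (d + 1) → (Fin (d + 1) → ℤ) → MKer (d + 1) (Fib d)} {CM δM : ℝ} (hM : VertexFamily M N CM δM)
    (hδM : 0 < δM) (μ : Fin (d + 1)) (y : Fin (d + 1) → ℤ) : Loc (vertexOfM K' N M μ y) := by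
  have hrpos : 0 < min m δM := lt_min hm hδM
  have h := SecondOrderResponse.biLoc_vertexOfM_of_biLoc (N := N) (biLoc_of_le hK' (min_le_left m δM))
    (fun ρ w => biLoc_of_le (hM ρ w) (min_le_right m δM)) hrpos μ y
  exact ⟨q, q, _, _, half_pos hrpos, h⟩

/-- [folklore] **THE SECOND-RESPONSE TADPOLE IS A SUPERPOSITION OF ONE-POINT FUNCTIONS.**  For a spread propagator `K`, any bi-localised
`K′` (the second response `K2OfK K N S M ν y′` is one), a local stencil family `S` and a multiplier vertex family `M`:
`tadpole K (dM K′ N S M μ y) = Σ_κ Σ'_u colH K′ N μ y κ u · tadpole K (S κ u) + Σ_ρ Σ'_w colM K′ N μ y ρ w · tadpole K (M ρ w)`. -/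
theorem tadpole_dM [NeZero N] {K K' : MKer (d + 1) (Fib d)} (hK : Spr K) {q : Fin (d + 1) → ℤ} {C' m : ℝ}
    (hK' : BiLoc K' q q C' m) (hm : 0 < m) {S : Fin (d + 1) → (Fin (d + 1) → ℤ) → MKer (d + 1) (Fib d)} {Cs δs : ℝ}
    (hS : LocStencil S Cs δs) (hδs : 0 < δs) {M : Fin (d + 1) → (Fin (d + 1) → ℤ) → MKer (d + 1) (Fib d)} {CM δM : ℝ}
    (hM : VertexFamily M N CM δM) (hδM : 0 < δM) (μ : Fin (d + 1)) (y : Fin (d + 1) → ℤ) :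
    tadpole K (dM K' N S M μ y) =
      (∑ κ : Fin (d + 1), ∑' u, colH K' N μ y κ u * tadpole K (S κ u))
        + ∑ ρ : Fin (d + 1), ∑' w, colM K' N μ y ρ w * tadpole K (M ρ w) := by
  unfold SecondOrderResponse.dM
  rw [tadpole_add hK (loc_vertexOfK hK' hm hS hδs μ y) (loc_vertexOfM hK' hm hM hδM μ y),
    tadpole_vertexOfK hK hK' hm hS hδs μ y, tadpole_vertexOfM hK hK' hm hM hδM μ y]

end Response

/-! ## §3 Criticality: vanishing one-point functions kill the second-response summand -/

section Critical

variable {d : ℕ} {N : ℕ} [NeZero N]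

/-- [folklore] **CRITICALITY.**  If every one-point function of the first-order tables vanishes — `tadpole K (S κ u) = 0` and
`tadpole K (M ρ w) = 0` (in Bałaban's model: the colour trace `tr_C (ad t_e) = 0`, B12 (4.35); in the colourless model: wherever a parity
supplies it, `D1BFx.TadpoleParity`) — then the second-response summand `dM K′ N S M μ y` has NO tadpole, for any bi-localised `K′`. -/
theorem tadpole_dM_eq_zero_of_onePoint {K K' : MKer (d + 1) (Fib d)} (hK : Spr K) {q : Fin (d + 1) → ℤ} {C' m : ℝ}
    (hK' : BiLoc K' q q C' m) (hm : 0 < m) {S : Fin (d + 1) → (Fin (d + 1) → ℤ) → MKer (d + 1) (Fib d)} {Cs δs : ℝ}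
    (hS : LocStencil S Cs δs) (hδs : 0 < δs) {M : Fin (d + 1) → (Fin (d + 1) → ℤ) → MKer (d + 1) (Fib d)} {CM δM : ℝ}
    (hM : VertexFamily M N CM δM) (hδM : 0 < δM) (h1 : ∀ κ u, tadpole K (S κ u) = 0) (h2 : ∀ ρ w, tadpole K (M ρ w) = 0)
    (μ : Fin (d + 1)) (y : Fin (d + 1) → ℤ) : tadpole K (dM K' N S M μ y) = 0 := by
  rw [tadpole_dM hK hK' hm hS hδs hM hδM μ y]
  simp [h1, h2]

/-- [folklore] **THE CARRIER'S TADPOLE UNDER CRITICALITY.**  Under vanishing one-point functions the tadpole of the full second-order carrier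
`W2OfK K N S M S₂ M₂ μ y ν y′` equals the tadpole of its first three summands (bi-vertex + the two mixed terms): the second-response summand
`dM (K2OfK K N S M ν y′) N S M μ y` drops — the typed form of leaf R4's «`F′(1)∘(U_•)″` vanishes».  (The localisation of the three kept
summands and of the second response are taken as hypotheses; `SecondOrderResponse.vertexFamily₂_vertex2OfK` / `vertexFamily₂_mixOfK(_swap)` /
`vertexFamily_K2OfK` supply them for the typed tables.) -/
theorem tadpole_W2OfK_eq_of_onePoint {K : MKer (d + 1) (Fib d)} (hK : Spr K)
    {S : Fin (d + 1) → (Fin (d + 1) → ℤ) → MKer (d + 1) (Fib d)} {Cs δs : ℝ} (hS : LocStencil S Cs δs) (hδs : 0 < δs)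
    {M : Fin (d + 1) → (Fin (d + 1) → ℤ) → MKer (d + 1) (Fib d)} {CM δM : ℝ} (hM : VertexFamily M N CM δM) (hδM : 0 < δM)
    (S₂ : Fin (d + 1) → (Fin (d + 1) → ℤ) → Fin (d + 1) → (Fin (d + 1) → ℤ) → MKer (d + 1) (Fib d))
    (M₂ : Fin (d + 1) → (Fin (d + 1) → ℤ) → Fin (d + 1) → (Fin (d + 1) → ℤ) → MKer (d + 1) (Fib d))
    (μ : Fin (d + 1)) (y : Fin (d + 1) → ℤ) (ν : Fin (d + 1)) (y' : Fin (d + 1) → ℤ)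
    {q : Fin (d + 1) → ℤ} {C' m : ℝ} (hK2 : BiLoc (K2OfK K N S M ν y') q q C' m) (hm : 0 < m)
    (hA : Loc (vertex2OfK K N S₂ μ y ν y' + mixOfK K N M₂ μ y ν y' + mixOfK K N M₂ ν y' μ y))
    (h1 : ∀ κ u, tadpole K (S κ u) = 0) (h2 : ∀ ρ w, tadpole K (M ρ w) = 0) :
    tadpole K (W2OfK K N S M S₂ M₂ μ y ν y') =
      tadpole K (vertex2OfK K N S₂ μ y ν y' + mixOfK K N M₂ μ y ν y' + mixOfK K N M₂ ν y' μ y) := by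
  have hresp : Loc (dM (K2OfK K N S M ν y') N S M μ y) :=
    (loc_vertexOfK hK2 hm hS hδs μ y).add (loc_vertexOfM hK2 hm hM hδM μ y)
  show tadpole K (vertex2OfK K N S₂ μ y ν y' + mixOfK K N M₂ μ y ν y' + mixOfK K N M₂ ν y' μ y
      + dM (K2OfK K N S M ν y') N S M μ y) = _
  rw [tadpole_add hK hA hresp, tadpole_dM_eq_zero_of_onePoint hK hK2 hm hS hδs hM hδM h1 h2 μ y, add_zero]

end Critical

end

end Summit.QuantumFields.BalabanUV.Beta.D1BFx.Criticality
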